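import Literature.MathematicalPhysics.QuantumFieldTheory.Balaban1983to89.Beta.AliasingTailL1
import Literature.MathematicalPhysics.QuantumFieldTheory.Balaban1983to89.Beta.AliasingTailSlice

/-!
# Aliasing tail, TWO STRATA: the axial frequencies at the `ℓ^∞` (one-coordinate) rate, the rest at an `ℓ¹` rate of
# smaller width

Companion to `Beta.AliasingTail` (`ℓ^∞` leaf, constant `aliasConst κ N d ≈ 3^{d+1} e^{-κN}`), `Beta.AliasingTailL1` (`ℓ¹` leaf,
constant `aliasConstL1 κ N d ≈ 2(d+1) e^{-κN}`, but over POLYSTRIP data) and `Beta.AliasingTailSlice` (the `ℓ^∞` leaf over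
ONE-COORDINATE data).  The counting observation made explicit here: in the periodisation error `Σ_{m ≠ 0} K(Nm)` the
`2(d+1)` AXIAL frequencies `m = k e_i` are the only ones at `ℓ¹`-distance `N` from the origin; every other frequency has
`|m|_1 ≥ 2`.  Hence with TWO decay bounds for the same kernel — `‖K(y)‖ ≤ M₁ e^{-κ|y|_∞}` (from one-coordinate strips of
half-width `κ`) and `‖K(y)‖ ≤ M′ e^{-κ′|y|_1}` (from the polystrip of a possibly much SMALLER half-width `κ′`) —
`‖Σ_m K(Nm) − K(0)‖ ≤ M₁ · 2(d+1)ρ/(1−ρ) + M′ · [((1+ρ′)/(1−ρ′))^{d+1} − 1 − 2(d+1)ρ′/(1−ρ′)]`, `ρ = e^{-κN}`, `ρ′ = e^{-κ′N}`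
(`norm_tsum_translate_sub_le_strata`): the leading constant is the `ℓ¹` one, `2(d+1)`, although only one-coordinate data
enter at the large width `κ`; the second stratum is `O(ρ′²)`, so `κ′` slightly above `κ/2` already makes it subdominant.

HONEST FRAMING (cell rule, p. 1 of everything).  Discharging `BetaPertH` makes Bałaban's UV stability UNCONDITIONAL — a
real constructive-QFT result; it is NOT the continuum limit and NOT the Clay problem.  This file is KERNEL GLUE (a counting
lemma and its export); no multiplier is instantiated, no value of `κ, κ′, M₁, M′, N` is asserted, no certificate row is
consumed or produced (RULING R15-1).  "No internally-minted statement may enter as a cited fact.  Every hypothesis is either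
kernel-proved in this package or a verbatim quotation of a PUBLISHED theorem with page reference."  Everything below is
kernel-proved from Mathlib and the tree; the citations locate the classical statements (periodisation / Poisson summation
of an exponentially decaying kernel; the trapezoidal rule for periodic analytic integrands).

## Sources
* Bałaban, Propagators I (1984), p. 36 l. 20–23 with p. 38 (1.126) — the torus dictionary (periodisation «in the usual
  way»), as in `AliasingTail`/`AliasingTailL1`.
* Trefethen–Weideman, SIAM Rev. 56 (2014), Thm. 4.2 eq. (4.16) with §4 eq. (4.9), p. 13–14 — the one-dimensional prototype
  (aliasing error of the trapezoidal rule = sum of the Fourier coefficients at the nonzero multiples of `N`).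

## Contents
* §1 `axialConst`, `bulkConst` (and `bulkConst_nonneg`, Bernoulli).
* §2 the axial indicator weights and their sums (`axialWeight`, `hasSum_axialWeightAt`, `hasSum_axialWeight`).
* §3 `norm_tsum_translate_sub_le_strata` — the two-stratum aliasing tail over DECAY hypotheses.
* §4 the torus reading and the export inequality `lo_le_of_aliasing_strata` over REGULARITY data: `StripRegularC G κ′ M′`
  (polystrip, small width; also used for the descent) and `∀ i, SliceRegular G i κ M₁` (one-coordinate, large width) —
  resp. `BoundarySliceRegular` (`lo_le_of_aliasing_strata_boundary`).

## What is NOT here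
Any concrete multiplier or number; finer stratifications (by support size `|supp m| = j` with widths `κ_j`, which would
replace `bulkConst` by `Σ_{j ≥ 2} C(d+1, j) (2ρ_j/(1−ρ_j))^j`) — not needed at the sizes of the lane.
-/

namespace Literature.MathematicalPhysics.QuantumFieldTheory.Balaban1983to89.Beta.AliasingTailStrata

open Complex Set Filter MeasureTheory
open Literature.MathematicalPhysics.QuantumFieldTheory.Balaban1983to89.B4Strip (ofRealVec Strip)
open Literature.MathematicalPhysics.QuantumFieldTheory.Balaban1983to89.B4ContourShift
open Literature.MathematicalPhysics.QuantumFieldTheory.Balaban1983to89.B4TorusKernel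
open Literature.MathematicalPhysics.QuantumFieldTheory.Balaban1983to89.Beta.AliasingTail
open Literature.MathematicalPhysics.QuantumFieldTheory.Balaban1983to89.Beta.AliasingTailL1
open Literature.MathematicalPhysics.QuantumFieldTheory.Balaban1983to89.Beta.AliasingTailSlice
open scoped Real Topology

noncomputable section

variable {d : ℕ}

/-! ### §1. The two constants -/

/-- the AXIAL constant `2(d+1)·ρ/(1−ρ)`, `ρ = e^{-κN}`: the sum of `e^{-κN|k|}` over the `2(d+1)` half-axes `m = k e_i`,
`k ≠ 0`. [cite: TrefethenWeideman2014, Thm. 4.2 eq. (4.16) with §4 eq. (4.9), p. 13–14, dictionary: one geometric tail per half-axis] -/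
def axialConst (κ : ℝ) (N d : ℕ) : ℝ := 2 * (d + 1) * (aliasRatioL1 κ N / (1 - aliasRatioL1 κ N))

/-- the BULK constant `((1+ρ)/(1−ρ))^{d+1} − 1 − 2(d+1)ρ/(1−ρ)` (`= aliasConstL1 − axialConst`), `ρ = e^{-κN}`: the `ℓ¹`
product majorant summed over the frequencies with at least two nonzero coordinates; it is `O(ρ²)`.
[cite: Balaban1984PropagatorsI, p. 36 l. 20–23, dictionary] -/
def bulkConst (κ : ℝ) (N d : ℕ) : ℝ := aliasConstL1 κ N d - axialConst κ N d

/-- `bulkConst ≥ 0` (Bernoulli: `(1 + x)^{d+1} ≥ 1 + (d+1)x` with `x = 2ρ/(1−ρ)`), for `κ > 0`, `N ≥ 1`.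
[cite: Balaban1984PropagatorsI, p. 36 l. 20–23, dictionary] -/
theorem bulkConst_nonneg {κ : ℝ} (hκ : 0 < κ) {N : ℕ} (hN : 1 ≤ N) (d : ℕ) : 0 ≤ bulkConst κ N d := by
  unfold bulkConst aliasConstL1 axialConst
  set ρ := aliasRatioL1 κ N with hρ
  have h0 : 0 ≤ ρ := (aliasRatioL1_pos κ N).le
  have h1 : ρ < 1 := aliasRatioL1_lt_one hκ hN
  have hx : 0 ≤ 2 * (ρ / (1 - ρ)) := by
    have : 0 ≤ ρ / (1 - ρ) := div_nonneg h0 (by linarith)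
    linarith
  have hne : (1 - ρ) ≠ 0 := by linarith
  have hq : (1 + ρ) / (1 - ρ) = 1 + 2 * (ρ / (1 - ρ)) := by
    field_simp
    ring
  have hb := one_add_mul_le_pow (by linarith : (-2 : ℝ) ≤ 2 * (ρ / (1 - ρ))) (d + 1)
  rw [hq]
  push_cast at hb ⊢
  linarith

/-! ### §2. Weights -/

/-- `ρ^{|k|} = e^{-κN|k|}` for `ρ = e^{-κN}`. [cite: TrefethenWeideman2014, §4 eq. (4.9), p. 13, dictionary] -/
theorem absWeight_aliasRatioL1 (κ : ℝ) (N : ℕ) (k : ℤ) :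
    absWeight (aliasRatioL1 κ N) k = Real.exp (-(κ * N * |(k : ℝ)|)) := by
  unfold absWeight aliasRatioL1
  rw [← Real.exp_nat_mul, Nat.cast_natAbs, Int.cast_abs]
  ring_nf

/-- the product of the weights of a lattice vector is `e^{-κN|m|_1}·`, i.e. `e^{-κ |Nm|_1}`.
[cite: Balaban1984PropagatorsI, p. 36 l. 20–23, dictionary] -/
theorem prod_absWeight_eq_exp (κ : ℝ) (N : ℕ) (m : Fin (d + 1) → ℤ) :
    ∏ i, absWeight (aliasRatioL1 κ N) (m i) = Real.exp (-(κ * l1Norm (translate N 0 m))) := by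
  rw [l1Norm_translate_zero]
  unfold l1Norm
  have e : -(κ * ((N : ℝ) * ∑ i, |((m i : ℤ) : ℝ)|)) = ∑ i, -(κ * N * |((m i : ℤ) : ℝ)|) := by
    rw [Finset.mul_sum, Finset.mul_sum, ← Finset.sum_neg_distrib]
    refine Finset.sum_congr rfl fun i _ => ?_
    ring
  rw [e, Real.exp_sum]
  refine Finset.prod_congr rfl fun i _ => ?_
  rw [absWeight_aliasRatioL1]

/-- the AXIAL INDICATOR WEIGHT at coordinate `i`: `ρ^{|m_i|}` if `m` is a nonzero multiple of `e_i`, else `0`.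
[cite: TrefethenWeideman2014, Thm. 4.2 eq. (4.16), p. 14, dictionary] -/
def axialWeightAt (ρ : ℝ) (i : Fin (d + 1)) (m : Fin (d + 1) → ℤ) : ℝ :=
  if m i ≠ 0 ∧ m = Pi.single i (m i) then absWeight ρ (m i) else 0

/-- the AXIAL WEIGHT: the sum over the coordinates of the axial indicator weights.
[cite: TrefethenWeideman2014, Thm. 4.2 eq. (4.16), p. 14, dictionary] -/
def axialWeight (ρ : ℝ) (m : Fin (d + 1) → ℤ) : ℝ := ∑ i, axialWeightAt ρ i m

/-- on a nonzero multiple of `e_i` only the `i`-th indicator fires: `axialWeight ρ (single i k) = ρ^{|k|}`, `k ≠ 0`.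
[cite: TrefethenWeideman2014, Thm. 4.2 eq. (4.16), p. 14, dictionary] -/
theorem axialWeight_single (ρ : ℝ) (i : Fin (d + 1)) {k : ℤ} (hk : k ≠ 0) :
    axialWeight ρ (Pi.single i k : Fin (d + 1) → ℤ) = absWeight ρ k := by
  unfold axialWeight
  rw [Finset.sum_eq_single i]
  · simp [axialWeightAt, hk]
  · intro j _ hji
    unfold axialWeightAt
    rw [if_neg]
    intro h
    exact h.1 (by simp [hji])
  · intro h; exact absurd (Finset.mem_univ i) h

/-- off the axes the axial weight vanishes. [cite: TrefethenWeideman2014, Thm. 4.2 eq. (4.16), p. 14, dictionary] -/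
theorem axialWeight_of_not_axial (ρ : ℝ) {m : Fin (d + 1) → ℤ} (hm : ¬ ∃ i, m = Pi.single i (m i)) :
    axialWeight ρ m = 0 := by
  unfold axialWeight
  refine Finset.sum_eq_zero fun i _ => ?_
  unfold axialWeightAt
  rw [if_neg]
  intro h
  exact hm ⟨i, h.2⟩

/-- at the origin the axial weight vanishes. [cite: TrefethenWeideman2014, Thm. 4.2 eq. (4.16), p. 14, dictionary] -/
theorem axialWeight_zero (ρ : ℝ) : axialWeight ρ (0 : Fin (d + 1) → ℤ) = 0 := by
  unfold axialWeight
  refine Finset.sum_eq_zero fun i _ => ?_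
  simp [axialWeightAt]

/-- the product weight of a nonzero multiple of `e_i` is `ρ^{|k|}`. [cite: Balaban1984PropagatorsI, p. 36 l. 20–23, dictionary] -/
theorem prod_absWeight_single (ρ : ℝ) (i : Fin (d + 1)) (k : ℤ) :
    ∏ j, absWeight ρ ((Pi.single i k : Fin (d + 1) → ℤ) j) = absWeight ρ k := by
  rw [Finset.prod_eq_single i]
  · simp
  · intro j _ hji
    simp [hji, absWeight]
  · intro h; exact absurd (Finset.mem_univ i) h

/-- the product weight of the origin is `1`. [cite: Balaban1984PropagatorsI, p. 36 l. 20–23, dictionary] -/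
theorem prod_absWeight_zero (ρ : ℝ) : ∏ j, absWeight ρ ((0 : Fin (d + 1) → ℤ) j) = 1 := by
  simp [absWeight]

/-- `Σ_{k ≠ 0} ρ^{|k|} = 2ρ/(1−ρ)` along the `i`-th axis: the sum of the axial indicator weight at `i`.
[cite: TrefethenWeideman2014, Thm. 4.2 eq. (4.16) with §4 eq. (4.9), p. 13–14, dictionary] -/
theorem hasSum_axialWeightAt {ρ : ℝ} (h0 : 0 ≤ ρ) (h1 : ρ < 1) (i : Fin (d + 1)) :
    HasSum (axialWeightAt ρ i : (Fin (d + 1) → ℤ) → ℝ) (2 * (ρ / (1 - ρ))) := by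
  set e : ℤ → (Fin (d + 1) → ℤ) := fun k => Pi.single i k with he
  have hinj : Function.Injective e := by
    intro a b hab
    have := congrArg (fun m : Fin (d + 1) → ℤ => m i) hab
    simpa [he] using this
  have hsupp : ∀ m ∉ Set.range e, axialWeightAt ρ i m = 0 := by
    intro m hm
    unfold axialWeightAt
    rw [if_neg]
    intro h
    exact hm ⟨m i, by rw [he]; exact h.2.symm⟩
  rw [← hinj.hasSum_iff hsupp]
  have hcomp : (axialWeightAt ρ i ∘ e) = Function.update (absWeight ρ) 0 0 := by
    funext k
    simp only [Function.comp_apply, he, axialWeightAt, Pi.single_eq_same, Function.update_apply]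
    by_cases hk : k = 0
    · simp [hk]
    · simp [hk]
  rw [hcomp]
  have hw := hasSum_absWeight h0 h1
  have hsum : HasSum (absWeight ρ) ((1 + ρ) / (1 - ρ)) := by rw [← hw.2]; exact hw.1.hasSum
  have hu := hsum.update 0 0
  have hne : (1 - ρ) ≠ 0 := by linarith
  have e' : (0 : ℝ) - absWeight ρ 0 + (1 + ρ) / (1 - ρ) = 2 * (ρ / (1 - ρ)) := by
    simp only [absWeight, Int.natAbs_zero, pow_zero]
    field_simp
    ring
  rw [e'] at hu
  exact hu

/-- `Σ_m axialWeight ρ m = 2(d+1)·ρ/(1−ρ)`. [cite: TrefethenWeideman2014, Thm. 4.2 eq. (4.16), p. 14, dictionary] -/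
theorem hasSum_axialWeight {ρ : ℝ} (h0 : 0 ≤ ρ) (h1 : ρ < 1) :
    HasSum (axialWeight ρ : (Fin (d + 1) → ℤ) → ℝ) (2 * (d + 1) * (ρ / (1 - ρ))) := by
  have h := hasSum_sum (s := (Finset.univ : Finset (Fin (d + 1))))
    (f := fun i (m : Fin (d + 1) → ℤ) => axialWeightAt ρ i m) (fun i _ => hasSum_axialWeightAt h0 h1 i)
  simp only [Finset.sum_const, Finset.card_univ, Fintype.card_fin, nsmul_eq_mul] at h
  have e : ((d + 1 : ℕ) : ℝ) * (2 * (ρ / (1 - ρ))) = 2 * (d + 1) * (ρ / (1 - ρ)) := by push_cast; ring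
  rw [e] at h
  exact h

/-! ### §3. The two-stratum aliasing tail -/

/-- THE TWO-STRATUM ALIASING TAIL.  Two decay bounds for the same kernel, `‖K(y)‖ ≤ M₁ e^{-κ|y|_∞}` and
`‖K(y)‖ ≤ M′ e^{-κ′|y|_1}` (`κ, κ′ > 0`), `N ≥ 1` ⇒ the periodisation converges and
`‖Σ_m K(Nm) − K(0)‖ ≤ M₁·axialConst κ N d + M′·bulkConst κ′ N d`: the axial frequencies `m = k e_i` are charged to the first
bound (`|k e_i|_∞ = |k|`), all the others to the second (`|m|_1 ≥ 2` there, whence `bulkConst = O(e^{-2κ′N})`).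
[cite: Balaban1984PropagatorsI, p. 36 l. 20–23, dictionary] [cite: TrefethenWeideman2014, Thm. 4.2 eq. (4.16), p. 14, dictionary] -/
theorem norm_tsum_translate_sub_le_strata (K : (Fin (d + 1) → ℤ) → ℂ) {κ M₁ κ' M' : ℝ} (hκ : 0 < κ) (hκ' : 0 < κ')
    (hK : ∀ y, ‖K y‖ ≤ M₁ * Real.exp (-(κ * supNorm y))) (hK' : ∀ y, ‖K y‖ ≤ M' * Real.exp (-(κ' * l1Norm y)))
    {N : ℕ} (hN : 1 ≤ N) :
    Summable (fun m : Fin (d + 1) → ℤ => K (translate N 0 m)) ∧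
      ‖(∑' m : Fin (d + 1) → ℤ, K (translate N 0 m)) - K 0‖ ≤ M₁ * axialConst κ N d + M' * bulkConst κ' N d := by
  have hs : Summable (fun m : Fin (d + 1) → ℤ => K (translate N 0 m)) := (norm_tsum_translate_sub_le K hκ hK hN).1
  refine ⟨hs, ?_⟩
  have hM₁ : 0 ≤ M₁ := by
    have h := hK 0
    have : supNorm (0 : Fin (d + 1) → ℤ) = 0 := by
      apply le_antisymm _ (supNorm_nonneg _)
      unfold supNorm; apply Finset.sup'_le; intro i _; simp
    rw [this] at h; simp at h; exact le_trans (norm_nonneg _) h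
  set ρ := aliasRatioL1 κ N with hρ
  set ρ' := aliasRatioL1 κ' N with hρ'
  have hρ0 : 0 ≤ ρ := (aliasRatioL1_pos κ N).le
  have hρ1 : ρ < 1 := aliasRatioL1_lt_one hκ hN
  have hρ'0 : 0 ≤ ρ' := (aliasRatioL1_pos κ' N).le
  have hρ'1 : ρ' < 1 := aliasRatioL1_lt_one hκ' hN
  -- the off-centre part as an `ite`
  set g : (Fin (d + 1) → ℤ) → ℂ := fun m => if m = 0 then 0 else K (translate N 0 m) with hg
  have hdecomp : (∑' m : Fin (d + 1) → ℤ, K (translate N 0 m)) = K 0 + ∑' m, g m := by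
    have := hs.tsum_eq_add_tsum_ite 0
    simpa [hg] using this
  rw [hdecomp, add_sub_cancel_left]
  -- the pieces of the majorant
  set P : (Fin (d + 1) → ℤ) → ℝ := fun m => ∏ i, absWeight ρ' (m i) with hP
  set Z : (Fin (d + 1) → ℤ) → ℝ := fun m => if m = 0 then 1 else 0 with hZ
  set F : (Fin (d + 1) → ℤ) → ℝ := fun m => M₁ * axialWeight ρ m + M' * (P m - Z m - axialWeight ρ' m) with hF
  have hPsum : HasSum P (((1 + ρ') / (1 - ρ')) ^ (d + 1)) := by
    have hw := hasSum_absWeight hρ'0 hρ'1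
    have hprod := summable_prod_pi (fun (_ : Fin (d + 1)) (j : ℤ) => absWeight ρ' j)
      (fun _ j => absWeight_nonneg hρ'0 j) (fun _ => hw.1)
    have h := hprod.1.hasSum
    rw [hprod.2] at h
    simp only [Finset.prod_const, Finset.card_univ, Fintype.card_fin, hw.2] at h
    exact h
  have hZsum : HasSum Z 1 := by
    have := hasSum_ite_eq (0 : Fin (d + 1) → ℤ) (1 : ℝ)
    exact this
  have hFsum : HasSum F (M₁ * axialConst κ N d + M' * bulkConst κ' N d) := by
    have hA := hasSum_axialWeight (d := d) hρ0 hρ1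
    have hA' := hasSum_axialWeight (d := d) hρ'0 hρ'1
    have h := (hA.mul_left M₁).add (((hPsum.sub hZsum).sub hA').mul_left M')
    have e : M₁ * (2 * (d + 1) * (ρ / (1 - ρ))) + M' * (((1 + ρ') / (1 - ρ')) ^ (d + 1) - 1 - 2 * (d + 1) * (ρ' / (1 - ρ')))
        = M₁ * axialConst κ N d + M' * bulkConst κ' N d := by
      unfold bulkConst aliasConstL1 axialConst
      rw [← hρ, ← hρ']
    rw [e] at h
    exact h
  -- the pointwise comparison
  have hgF : ∀ m, ‖g m‖ ≤ F m := by
    intro m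
    rcases eq_or_ne m 0 with rfl | hm
    · simp only [hg, if_true, norm_zero, hF, hZ, hP, axialWeight_zero, prod_absWeight_zero, mul_zero, sub_self,
        zero_add]
      rfl
    · simp only [hg, hm, if_false, hF, hZ, sub_zero]
      by_cases hax : ∃ i, m = Pi.single i (m i)
      · -- an axial frequency: charge it to the sup-norm bound
        obtain ⟨i, hi⟩ := hax
        set k := m i with hk
        have hk0 : k ≠ 0 := by
          intro h0; apply hm; rw [hi, h0, Pi.single_zero]
        have hax1 : axialWeight ρ m = absWeight ρ k := by rw [hi]; exact axialWeight_single ρ i hk0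
        have hax2 : axialWeight ρ' m = absWeight ρ' k := by rw [hi]; exact axialWeight_single ρ' i hk0
        have hP1 : P m = absWeight ρ' k := by simp only [hP]; rw [hi]; exact prod_absWeight_single ρ' i k
        rw [hax1, hax2, hP1, sub_self, mul_zero, add_zero]
        have hsup : (N : ℝ) * |(k : ℝ)| ≤ supNorm (translate N 0 m) := by
          have h := abs_le_supNorm (translate N 0 m) i
          rw [translate_zero_apply, Int.cast_abs] at h
          push_cast at h
          rw [abs_mul, abs_of_nonneg (by positivity : (0 : ℝ) ≤ N)] at h
          exact h
        calc ‖K (translate N 0 m)‖ ≤ M₁ * Real.exp (-(κ * supNorm (translate N 0 m))) := hK _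
          _ ≤ M₁ * Real.exp (-(κ * N * |(k : ℝ)|)) := by
              refine mul_le_mul_of_nonneg_left (Real.exp_le_exp.mpr ?_) hM₁
              have := mul_le_mul_of_nonneg_left hsup hκ.le
              linarith
          _ = M₁ * absWeight ρ k := by rw [hρ, absWeight_aliasRatioL1]
      · -- a bulk frequency: charge it to the ℓ¹ bound
        rw [axialWeight_of_not_axial ρ hax, axialWeight_of_not_axial ρ' hax, mul_zero, zero_add, sub_zero]
        calc ‖K (translate N 0 m)‖ ≤ M' * Real.exp (-(κ' * l1Norm (translate N 0 m))) := hK' _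
          _ = M' * P m := by simp only [hP]; rw [hρ', prod_absWeight_eq_exp]
  have hFs : Summable F := hFsum.summable
  have hgs : Summable (fun m => ‖g m‖) := Summable.of_nonneg_of_le (fun m => norm_nonneg _) hgF hFs
  calc ‖∑' m, g m‖ ≤ ∑' m, ‖g m‖ := norm_tsum_le_tsum_norm hgs
    _ ≤ ∑' m, F m := hgs.tsum_le_tsum hgF hFs
    _ = M₁ * axialConst κ N d + M' * bulkConst κ' N d := hFsum.tsum_eq

/-! ### §4. The torus reading and the export inequality over regularity data -/

/-- GRID SUM VERSUS BRILLOUIN-ZONE MEAN, two strata: `StripRegularC G κ′ M′` (polystrip of half-width `κ′ > 0`; also the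
descent), `∀ i, SliceRegular G i κ M₁` (one-coordinate strips of half-width `κ > 0`), `N ≥ 1` ⇒
`‖T_N − latticeKernel G 0‖ ≤ M₁·axialConst κ N d + M′·bulkConst κ′ N d`.
[cite: Balaban1984PropagatorsI, p. 36 l. 20–23 with p. 38 (1.126), dictionary] -/
theorem norm_torusKernel_zero_sub_latticeKernel_zero_le_strata {G : (Fin (d + 1) → ℂ) → ℂ} {κ' M' κ M₁ : ℝ}
    (h' : StripRegularC G κ' M') (hκ' : 0 < κ') (hκ : 0 < κ) (hreg : ∀ i, SliceRegular G i κ M₁) {N : ℕ} (hN : 1 ≤ N) :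
    ‖torusKernel (descendC G (h'.toStripRegular hκ'.le) hκ'.le) N 0 - latticeKernel G 0‖
      ≤ M₁ * axialConst κ N d + M' * bulkConst κ' N d := by
  rw [torusKernel_descend_eq (h'.toStripRegular hκ'.le) hκ' hN 0]
  exact (norm_tsum_translate_sub_le_strata (latticeKernel G) hκ hκ'
    (latticeKernel_decay_slice (h'.toStripRegular hκ'.le) hκ'.le hκ.le hreg) (latticeKernel_decay_l1 h' hκ'.le) hN).2

/-- the certified-enclosure reading. [cite: Balaban1984PropagatorsI, p. 36 l. 20–23 with p. 38 (1.126), dictionary] -/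
theorem latticeKernel_zero_re_ge_strata {G : (Fin (d + 1) → ℂ) → ℂ} {κ' M' κ M₁ : ℝ}
    (h' : StripRegularC G κ' M') (hκ' : 0 < κ') (hκ : 0 < κ) (hreg : ∀ i, SliceRegular G i κ M₁) {N : ℕ} (hN : 1 ≤ N)
    {t r : ℝ} (hT : ‖torusKernel (descendC G (h'.toStripRegular hκ'.le) hκ'.le) N 0 - t‖ ≤ r) :
    t - r - (M₁ * axialConst κ N d + M' * bulkConst κ' N d) ≤ (latticeKernel G 0).re :=
  re_ge_of_enclosures hT (norm_torusKernel_zero_sub_latticeKernel_zero_le_strata h' hκ' hκ hreg hN)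

/-- THE EXPORT INEQUALITY, two strata (shape of `Certified.lo_le_of_aliasing`): (Z′) `StripRegularC G κ′ M′`, `κ′ > 0`;
(Z¹) `∀ i, SliceRegular G i κ M₁`, `κ > 0`; (T) `‖T_N − t‖ ≤ r`, `N ≥ 1`; (A) `A ≥ M₁·axialConst κ N d + M′·bulkConst κ′ N d`
and a rational `lo ≤ t − r − A` ⇒ `lo ≤ Re (latticeKernel G 0)`.
[cite: TrefethenWeideman2014, Thm. 4.2 eq. (4.16) with §4 eq. (4.9), p. 13–14, dictionary] [cite: Balaban1984PropagatorsI, p. 36 l. 20–23 with p. 38 (1.126), dictionary] -/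
theorem lo_le_of_aliasing_strata {G : (Fin (d + 1) → ℂ) → ℂ} {κ' M' κ M₁ : ℝ}
    (h' : StripRegularC G κ' M') (hκ' : 0 < κ') (hκ : 0 < κ) (hreg : ∀ i, SliceRegular G i κ M₁) {N : ℕ} (hN : 1 ≤ N)
    {t r : ℝ} (hT : ‖torusKernel (descendC G (h'.toStripRegular hκ'.le) hκ'.le) N 0 - t‖ ≤ r)
    {A : ℝ} (hA : M₁ * axialConst κ N d + M' * bulkConst κ' N d ≤ A) {lo : ℚ} (hlo : ((lo : ℚ) : ℝ) ≤ t - r - A) :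
    ((lo : ℚ) : ℝ) ≤ (latticeKernel G 0).re := by
  have h := latticeKernel_zero_re_ge_strata h' hκ' hκ hreg hN hT
  linarith

/-- THE EXPORT INEQUALITY, two strata, over BOUNDARY data in the large-width stratum: as `lo_le_of_aliasing_strata` with
(Z¹) replaced by `∀ i, BoundarySliceRegular G i κ M₁` (`M₁` = a bound of `|G|` on the `2(d+1)` shifted real tori
`Im p_i = ±κ`). [cite: Conway1978, Ch. VI Lemma 3.10 with Thm. 3.7, p. 136, dictionary] [cite: Balaban1984PropagatorsI, p. 36 l. 20–23 with p. 38 (1.126), dictionary] -/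
theorem lo_le_of_aliasing_strata_boundary {G : (Fin (d + 1) → ℂ) → ℂ} {κ' M' κ M₁ : ℝ}
    (h' : StripRegularC G κ' M') (hκ' : 0 < κ') (hκ : 0 < κ) (hreg : ∀ i, BoundarySliceRegular G i κ M₁) {N : ℕ}
    (hN : 1 ≤ N) {t r : ℝ} (hT : ‖torusKernel (descendC G (h'.toStripRegular hκ'.le) hκ'.le) N 0 - t‖ ≤ r)
    {A : ℝ} (hA : M₁ * axialConst κ N d + M' * bulkConst κ' N d ≤ A) {lo : ℚ} (hlo : ((lo : ℚ) : ℝ) ≤ t - r - A) :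
    ((lo : ℚ) : ℝ) ≤ (latticeKernel G 0).re :=
  lo_le_of_aliasing_strata h' hκ' hκ (fun i => (hreg i).sliceRegular hκ) hN hT hA hlo

/-! ### §5. Rational-friendly majorants of the two constants -/

/-- `axialConst` is monotone in the ratio: `e^{-κN} ≤ ρu < 1` ⇒ `axialConst κ N d ≤ 2(d+1)ρu/(1−ρu)`.
[cite: TrefethenWeideman2014, §4 eq. (4.9), p. 13, dictionary] -/
theorem axialConst_le {κ : ℝ} {N d : ℕ} {ρu : ℝ} (hρ : aliasRatioL1 κ N ≤ ρu) (hρ1 : ρu < 1) :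
    axialConst κ N d ≤ 2 * (d + 1) * (ρu / (1 - ρu)) := by
  unfold axialConst
  have h0 : 0 < aliasRatioL1 κ N := aliasRatioL1_pos κ N
  have hmono : aliasRatioL1 κ N / (1 - aliasRatioL1 κ N) ≤ ρu / (1 - ρu) := by
    rw [div_le_div_iff₀ (by linarith) (by linarith)]
    nlinarith
  have : (0 : ℝ) ≤ 2 * (d + 1) := by positivity
  exact mul_le_mul_of_nonneg_left hmono this

/-- `bulkConst ≤ aliasConstL1` (the bulk is part of the full `ℓ¹` majorant), so `AliasingTailL1.aliasConstL1_le` bounds it by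
a rational-friendly expression. [cite: Balaban1984PropagatorsI, p. 36 l. 20–23, dictionary] -/
theorem bulkConst_le_aliasConstL1 {κ : ℝ} (hκ : 0 < κ) {N : ℕ} (hN : 1 ≤ N) (d : ℕ) :
    bulkConst κ N d ≤ aliasConstL1 κ N d := by
  unfold bulkConst axialConst
  have h0 : 0 ≤ aliasRatioL1 κ N := (aliasRatioL1_pos κ N).le
  have h1 : aliasRatioL1 κ N < 1 := aliasRatioL1_lt_one hκ hN
  have : 0 ≤ aliasRatioL1 κ N / (1 - aliasRatioL1 κ N) := div_nonneg h0 (by linarith)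
  have : (0 : ℝ) ≤ 2 * (d + 1) * (aliasRatioL1 κ N / (1 - aliasRatioL1 κ N)) := by positivity
  linarith

end

end Literature.MathematicalPhysics.QuantumFieldTheory.Balaban1983to89.Beta.AliasingTailStrata
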